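import Mathlib.Analysis.Calculus.FDeriv.Comp
import Mathlib.Analysis.Calculus.Deriv.Comp
import Mathlib.Analysis.InnerProductSpace.PiL2
import HarnessLib

/-!
# Crux K2 `PoloidalWindowRigidity` (stmt-NavierStokesRegularity-19708), line `z_shock` — R3 inhabitant census: ROTATING PATTERNS (XIV) —
# the source of the Riemann transport law in invariant coordinates: the self-interaction coefficient of the outgoing invariant `w₊` is
# `−γ'(Ψ)·(1/λ² + 1/γ(Ψ)²)/4` (genuine nonlinearity ⇒ Riccati sign), bookkeeping for census items F3/F4

`--supports stmt-NavierStokesRegularity-19708 --as helper` (leafhand-ns-poloidalwindowdoor-3 g9, cell decomp-ns, 2026-08-31).  Class-free,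
def-free, Mathlib only (algebra + one chain rule).  **No stub and no summit is closed by this file; Navier–Stokes regularity is NOT proved
here (rung 0).**

WHY THIS FILE.  Part XIII (`…RotatingProfileRiemann.rotating_riemann_transport`) transports the outgoing approximate Riemann invariant
`w₊ = p + λq` (`p = γ(Ψ)XΨ`, `q = ΘΨ`, `λ = √(mγ(Ψ))`, `m = ω²|y|² − γ(Ψ)`) with the zeroth-order source
`S₊ = (Θm + Xλ − (λ/a)Θλ)·q − λ·p·Θa/a²`, `a = γ(Ψ)`, `Θm = −Θa`.  For the forced Riccati kernel (`…ZShockRiccatiForced`) one needs `S₊` as a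
quadratic form in `(w₊, w₋)`; with `Θa = γ'(Ψ)·q` (chain rule, `angular_chain` below, writing `g = γ'(Ψ(y))`):

* ★ `source_in_invariants` — for reals `p, q, λ ≠ 0, a ≠ 0, g, L₁ = Xλ, L₂ = Θλ`:
  `(−g q + L₁ − (λ/a)L₂)·q − λ p g q/a² = −(g/4)(1/λ² + 1/a²)·w₊² + (g/(2λ²))·w₊w₋ − (g/4)(1/λ² − 1/a²)·w₋² + ((L₁ − λL₂/a)/(2λ))·(w₊ − w₋)`
  with `w± = p ± λq`.  The `w₊²`-coefficient is `−γ'(Ψ)(1/λ² + 1/γ²)/4 = −γ'(Ψ)·ω²|y|²/(4 m γ(Ψ)²)` (`self_coeff_eq`, using `λ² = m a`,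
  `m + a = ω²|y|²`): ONE-SIGNED under thickness of one sign — the Riccati self-interaction of census item F4; the cross and `w₋²` terms and the
  linear GEOMETRIC term `(L₁ − λL₂/a)/(2λ)·(w₊ − w₋)` are the forcing/damping to be controlled along characteristics.
* `angular_chain` — `Θ(γ∘Ψ)(y) = γ'(Ψ(y))·ΘΨ(y)` (so `Θa = g q`, `Θm = −g q`).

[folklore] (John 1974 §2: decomposition of the quadratic interaction coefficients)
-/

noncomputable section

namespace Summit.NavierStokesRegularity.NavierStokesRegularity.Theorems.PoloidalWindowDoorPoloidalWindowRigidityZShockRotatingProfileRiemannSource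

-- the summit and its single sub-problem share the name (CONVENTIONS §1)
set_option linter.dupNamespace false

open Set Filter Topology

/-- ★ **The transport source in invariant coordinates** (`w± = p ± λq`; pure algebra). [folklore] -/
theorem source_in_invariants (p q lam a g L1 L2 : ℝ) (hlam : lam ≠ 0) (ha : a ≠ 0) :
    (-(g * q) + L1 - lam / a * L2) * q - lam * p * (g * q) / a ^ 2 =
      -(g / 4 * (1 / lam ^ 2 + 1 / a ^ 2)) * (p + lam * q) ^ 2
        + g / (2 * lam ^ 2) * ((p + lam * q) * (p - lam * q))
        - g / 4 * (1 / lam ^ 2 - 1 / a ^ 2) * (p - lam * q) ^ 2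
        + (L1 - lam * L2 / a) / (2 * lam) * ((p + lam * q) - (p - lam * q)) := by
  field_simp
  ring

/-- **The self-interaction coefficient** in terms of the profile data: with `λ² = m·a` and `m + a = ω²|y|²` (`a = γ(Ψ)`),
`(1/λ² + 1/a²) = ω²|y|² / (m a²)`, so the `w₊²`-coefficient is `−g ω²|y|²/(4 m a²)`. [folklore] -/
theorem self_coeff_eq (lam a m g n2 : ℝ) (ha : a ≠ 0) (hm : m ≠ 0)
    (hlam2 : lam ^ 2 = m * a) (hsum : m + a = n2) :
    -(g / 4 * (1 / lam ^ 2 + 1 / a ^ 2)) = -(g * n2 / (4 * m * a ^ 2)) := by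
  rw [hlam2, ← hsum]
  field_simp
  ring

/-- **Angular chain rule**: `Θ(γ∘Ψ)(y) = γ'(Ψ(y))·ΘΨ(y)`, i.e. `D(γ∘Ψ)(y)[v] = γ'(Ψ y)·DΨ(y)[v]` for every direction `v`. [folklore] -/
theorem angular_chain {Ψ : EuclideanSpace ℝ (Fin 2) → ℝ} {γ γ' : ℝ → ℝ} (hΨ : Differentiable ℝ Ψ)
    (hγ : ∀ r, HasDerivAt γ (γ' r) r) (y v : EuclideanSpace ℝ (Fin 2)) :
    fderiv ℝ (fun y' => γ (Ψ y')) y v = γ' (Ψ y) * fderiv ℝ Ψ y v := by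
  have h : HasFDerivAt (fun y' => γ (Ψ y')) (γ' (Ψ y) • fderiv ℝ Ψ y) y :=
    (hγ (Ψ y)).comp_hasFDerivAt y (hΨ y).hasFDerivAt
  rw [h.fderiv]
  simp only [_root_.smul_apply, smul_eq_mul]

end Summit.NavierStokesRegularity.NavierStokesRegularity.Theorems.PoloidalWindowDoorPoloidalWindowRigidityZShockRotatingProfileRiemannSource
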